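import Summits.HodgeConjecture.CorCM.Model.Universe2
import Summits.HodgeConjecture.CorCM.Geometry.Facts
import Literature.AlgebraicGeometry.HodgeTheory.BettiUniverseCMTypes
import Literature.AlgebraicGeometry.Milne1999.CodesHCOfCMHodgeHypothesis
import Summits.HodgeConjecture.CorCM.Model.CMDominationOfRiemann
import HarnessLib

/-!
# `ModelAxioms` fields for the second model universe `Model2.universe₂`: the fifteen "free" fields (ports
# of the stage-1 kernel proofs; M11 `cmAV` with the INTRINSIC CM predicate) and M14 `Fact_cmDominated`
# (v2: from the cell's tree-level domination of EVERY complex abelian variety of CM type,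
# `Domination.cmDominated_of_isOfCMType_all[_of_riemann]`, `CorCM/Model/CMDominationOfRiemann.lean`)

Cell `pub-hodgecm2`, seat model-2 (gen 1 wrote the free fields; gen 2 the M14 junction v2).  KERNEL over the records.
M14 of `universe₂` is given in three forms: `universe₂_fact_cmDominated_of` (from ANY all-dimensions domination of CM
abelian varieties by the coded CM products), `universe₂_fact_cmDominated` (over the two Shimura binders and the GUARDED
coding binder `hDomPos` — B03 as re-typed 2026-08-20; the unguarded `hDom` of v1 is false, `Model.not_hDom`), and
`universe₂_fact_cmDominated_of_riemann` (modulo Riemann's theorem `hR` = row B02 ONLY, via `Model.hDomPos_of_riemann`,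
`thm3_isogenousPower_of_riemann`, `thm2_cor_of_riemann`).
-/

noncomputable section

open scoped TensorProduct
open NumberField CategoryTheory
open Literature.AlgebraicGeometry.Motives (CMType AbelianVariety bettiCohomology)
open Literature.AlgebraicGeometry.Motives
open Literature.AlgebraicGeometry.Motives.HodgeStructure (EndAction)

namespace Summit.HodgeConjecture.CorCM

namespace Model2

open Literature.NumberTheory.Automorphic
open Literature.NumberTheory.Automorphic.PicardCM (BallQuotientUniformisedDatum CMAbelianVarietyRealised
  cmRealisation CMCode eigenline)
open Literature.AlgebraicGeometry.HodgeTheory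
open Literature.AlgebraicGeometry.ComplexMultiplication (IsCMTypeRealisation)
open Literature.AlgebraicGeometry.Milne1999 (cmRealisation_isCMTypeRealisation)
open Summit.HodgeConjecture.CorCM


/-! ### The CM clauses of record (iii), transported along `e : K ≃+* (Model.cmCode K Φ).E` (stage-1
`Model/UniverseCM.lean` §CMFacts, verbatim statements; they concern the realisation only, not the index type) -/

section CMFacts

variable (K : CMField) (Φ : CMType K) (σ : K →+* ℂ)

/-- The abstract embedding `σ : K →+* ℂ` read on the code field is `σ' := σ ∘ e⁻¹` (written out; stage-1's
`Model.cmCodeEmb`), and `σ' ∘ e = σ`. [folklore] -/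
theorem cmCodeEmb_comp :
    (σ.comp (Model.cmCodeEquiv K Φ).symm.toRingHom).comp (Model.cmCodeEquiv K Φ).toRingHom = σ := by
  ext a; simp

/-- `σ' ∈ Φ_code ↔ σ ∈ Φ`. [folklore] -/
theorem cmCodeEmb_mem_iff : σ.comp (Model.cmCodeEquiv K Φ).symm.toRingHom ∈ (Model.cmCode K Φ).Φ.1 ↔ σ ∈ Φ.1 := by
  change (σ.comp (Model.cmCodeEquiv K Φ).symm.toRingHom).comp (Model.cmCodeEquiv K Φ).toRingHom ∈ Φ.1 ↔ _
  rw [cmCodeEmb_comp]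

/-- The joint `σ`-eigenspace of the transported action `R.θ ∘ e` is the record's `σ'`-eigenline. [folklore] -/
theorem iInf_eigenspace_cmCode (h₃ : CMAbelianVarietyRealised) :
    (⨅ a : K, Module.End.eigenspace
        (((cmRealisation h₃ (Model.cmCode K Φ)).θ.comp (Model.cmCodeEquiv K Φ).toRingHom) a) (σ a)) =
      eigenline (cmRealisation h₃ (Model.cmCode K Φ)).θ (σ.comp (Model.cmCodeEquiv K Φ).symm.toRingHom) := by
  have h := BettiUniverse.iInf_eigenspace_comp_ringEquiv (cmRealisation h₃ (Model.cmCode K Φ)).θ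
    (Model.cmCodeEquiv K Φ) (σ.comp (Model.cmCodeEquiv K Φ).symm.toRingHom)
  rw [cmCodeEmb_comp] at h
  exact h

/-- Clause `finrank_eigenline` of (iii), transported. [folklore] -/
theorem finrank_iInf_eigenspace_cmCode (h₃ : CMAbelianVarietyRealised) :
    Module.finrank ℂ ↥(⨅ a : K, Module.End.eigenspace
        (((cmRealisation h₃ (Model.cmCode K Φ)).θ.comp (Model.cmCodeEquiv K Φ).toRingHom) a) (σ a)) = 1 := by
  rw [iInf_eigenspace_cmCode]
  exact (cmRealisation h₃ (Model.cmCode K Φ)).finrank_eigenline _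

/-- Clause `hodgeType_of_mem` of (iii), transported. [folklore] -/
theorem hodgeType_of_mem_cmCode (h₃ : CMAbelianVarietyRealised) (hσ : σ ∈ Φ.1) :
    ∀ v ∈ ⨅ a : K, Module.End.eigenspace
        (((cmRealisation h₃ (Model.cmCode K Φ)).θ.comp (Model.cmCodeEquiv K Φ).toRingHom) a) (σ a),
      IsOfHodgeType (Module.finrank ℚ (Model.cmCode K Φ).E / 2) (cmRealisation h₃ (Model.cmCode K Φ)).A 1 1 0 v := by
  rw [iInf_eigenspace_cmCode]
  exact (cmRealisation h₃ (Model.cmCode K Φ)).hodgeType_of_mem _ ((cmCodeEmb_mem_iff K Φ σ).2 hσ)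

/-- Clause `hodgeType_of_not_mem` of (iii), transported. [folklore] -/
theorem hodgeType_of_not_mem_cmCode (h₃ : CMAbelianVarietyRealised) (hσ : σ ∉ Φ.1) :
    ∀ v ∈ ⨅ a : K, Module.End.eigenspace
        (((cmRealisation h₃ (Model.cmCode K Φ)).θ.comp (Model.cmCodeEquiv K Φ).toRingHom) a) (σ a),
      IsOfHodgeType (Module.finrank ℚ (Model.cmCode K Φ).E / 2) (cmRealisation h₃ (Model.cmCode K Φ)).A 1 0 1 v := by
  rw [iInf_eigenspace_cmCode]
  exact (cmRealisation h₃ (Model.cmCode K Φ)).hodgeType_of_not_mem _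
    (fun h ↦ hσ ((cmCodeEmb_mem_iff K Φ σ).1 h))

end CMFacts

/-! ### The free fields for `universe₂` -/

/-- **M1 `Fact_pull_id`** for `universe₂`: `𝟙^* = id` (`BettiUniverse.pull_id`). [folklore] -/
theorem universe₂_fact_pull_id (hHD : exists_isReal_hodgeModel) (hI : hodgePQ_independent_of_hodgeModel)
    (hU : BallQuotientUniformisedDatum) (h₃ : CMAbelianVarietyRealised) : (universe₂ hHD hI hU h₃).Fact_pull_id :=
  fun X k ↦ BettiUniverse.pull_id (IsoComplete.Var.scheme hU h₃ X) k

/-- **`Fact_pull_comp`** for `universe₂` (`BettiUniverse.pull_comp`). [folklore] -/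
theorem universe₂_fact_pull_comp (hHD : exists_isReal_hodgeModel) (hI : hodgePQ_independent_of_hodgeModel)
    (hU : BallQuotientUniformisedDatum) (h₃ : CMAbelianVarietyRealised) : (universe₂ hHD hI hU h₃).Fact_pull_comp :=
  fun _ _ _ f g k ↦ BettiUniverse.pull_comp f g k

/-- **`Fact_pull_cup`** for `universe₂` (`BettiUniverse.pull_cup`). [folklore] -/
theorem universe₂_fact_pull_cup (hHD : exists_isReal_hodgeModel) (hI : hodgePQ_independent_of_hodgeModel)
    (hU : BallQuotientUniformisedDatum) (h₃ : CMAbelianVarietyRealised) : (universe₂ hHD hI hU h₃).Fact_pull_cup :=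
  fun _ _ f i j x y ↦ BettiUniverse.pull_cup f i j x y

/-- **`Fact_pull_hodge`** for `universe₂` (`BettiUniverse.pull_hodge`). [folklore] -/
theorem universe₂_fact_pull_hodge (hHD : exists_isReal_hodgeModel) (hI : hodgePQ_independent_of_hodgeModel)
    (hU : BallQuotientUniformisedDatum) (h₃ : CMAbelianVarietyRealised) : (universe₂ hHD hI hU h₃).Fact_pull_hodge :=
  fun X Y f k p ↦ BettiUniverse.pull_hodge hHD hI (IsoComplete.Var.isSmoothProjective hU h₃ X)
    (IsoComplete.Var.isSmoothProjective hU h₃ Y) f k p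

/-- **`Fact_cup2_hodge`** for `universe₂` (`BettiUniverse.cup2_hodge`). [folklore] -/
theorem universe₂_fact_cup2_hodge (hHD : exists_isReal_hodgeModel) (hI : hodgePQ_independent_of_hodgeModel)
    (hU : BallQuotientUniformisedDatum) (h₃ : CMAbelianVarietyRealised) : (universe₂ hHD hI hU h₃).Fact_cup2_hodge :=
  fun X k p q x y hx hy ↦
    BettiUniverse.cup2_hodge hHD hI (IsoComplete.Var.isSmoothProjective hU h₃ X) k p q x y hx hy

/-- **`PmsDimTwo`** for `universe₂` (by `rfl`). [folklore] -/
theorem universe₂_pmsDimTwo (hHD : exists_isReal_hodgeModel) (hI : hodgePQ_independent_of_hodgeModel)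
    (hU : BallQuotientUniformisedDatum) (h₃ : CMAbelianVarietyRealised)
    : (universe₂ hHD hI hU h₃).PmsDimTwo := fun _ _ _ _ ↦ rfl

/-- **M6 `Fact_tr_degree`** for `universe₂` (`BettiUniverse.tr_of_ne`). [folklore] -/
theorem universe₂_fact_tr_degree (hHD : exists_isReal_hodgeModel) (hI : hodgePQ_independent_of_hodgeModel)
    (hU : BallQuotientUniformisedDatum) (h₃ : CMAbelianVarietyRealised) : (universe₂ hHD hI hU h₃).Fact_tr_degree :=
  fun X _ hk ↦ BettiUniverse.tr_of_ne (IsoComplete.Var.isSmoothProjective hU h₃ X) hk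

/-- **M19 `Fact_cup_comm1`** for `universe₂` (`BettiUniverse.cup_comm_one`). [folklore] -/
theorem universe₂_fact_cup_comm1 (hHD : exists_isReal_hodgeModel) (hI : hodgePQ_independent_of_hodgeModel)
    (hU : BallQuotientUniformisedDatum) (h₃ : CMAbelianVarietyRealised) : (universe₂ hHD hI hU h₃).Fact_cup_comm1 :=
  fun _ a b ↦ BettiUniverse.cup_comm_one a b

/-- **M20 `Fact_cup_interchange`** for `universe₂` (`BettiUniverse.cup_interchange_one`). [folklore] -/
theorem universe₂_fact_cup_interchange (hHD : exists_isReal_hodgeModel) (hI : hodgePQ_independent_of_hodgeModel)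
    (hU : BallQuotientUniformisedDatum) (h₃ : CMAbelianVarietyRealised)
    : (universe₂ hHD hI hU h₃).Fact_cup_interchange :=
  fun _ a b c d ↦ BettiUniverse.cup_interchange_one a b c d

/-- **M22 `Fact_H1_rank`** for `universe₂`: `dim_ℚ H¹(A_{(K,Φ)}, ℚ) = [K:ℚ]`. [folklore] -/
theorem universe₂_fact_H1_rank (hHD : exists_isReal_hodgeModel) (hI : hodgePQ_independent_of_hodgeModel)
    (hU : BallQuotientUniformisedDatum) (h₃ : CMAbelianVarietyRealised) : (universe₂ hHD hI hU h₃).Fact_H1_rank := by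
  intro K Φ
  change Module.finrank ℚ (bettiCohomology (cmRealisation h₃ (Model.cmCode K Φ)).A 1) = _
  rw [BettiUniverse.finrank_bettiCohomology_eq (cmRealisation h₃ (Model.cmCode K Φ)).isSmoothProjective 1,
    (cmRealisation h₃ (Model.cmCode K Φ)).finrank_eq, Model.cmCode, CMCode.finrank_ofCMType_E]

/-- **M11 `Fact_cmAV`** for `universe₂`, with the INTRINSIC content predicates: the realisation of the code
IS an abelian variety of CM type in Milne's sense (`IsCMTypeRealisation.isOfCMType` on
`cmRealisation_isCMTypeRealisation`), of dimension `[K:ℚ]/2`. [cite: Milne1999, §2 p. 54] -/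
theorem universe₂_fact_cmAV (hHD : exists_isReal_hodgeModel) (hI : hodgePQ_independent_of_hodgeModel)
    (hU : BallQuotientUniformisedDatum) (h₃ : CMAbelianVarietyRealised) : (universe₂ hHD hI hU h₃).Fact_cmAV := by
  intro K Φ
  refine ⟨⟨(cmRealisation h₃ (Model.cmCode K Φ)).AV, ⟨Iso.refl _⟩⟩,
    ⟨(cmRealisation h₃ (Model.cmCode K Φ)).AV,
      IsCMTypeRealisation.isOfCMType (cmRealisation_isCMTypeRealisation h₃ (Model.cmCode K Φ)), ⟨Iso.refl _⟩⟩, ?_⟩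
  change Module.finrank ℚ (Model.cmCode K Φ).E / 2 = Module.finrank ℚ K / 2
  rw [Model.cmCode, CMCode.finrank_ofCMType_E]

/-- **M12 `Fact_eigenLine`** for `universe₂` (`BettiUniverse.finrank_eigenLine_eq_one`). [folklore] -/
theorem universe₂_fact_eigenLine (hHD : exists_isReal_hodgeModel) (hI : hodgePQ_independent_of_hodgeModel)
    (hU : BallQuotientUniformisedDatum) (h₃ : CMAbelianVarietyRealised) : (universe₂ hHD hI hU h₃).Fact_eigenLine :=
  fun K Φ σ ↦ BettiUniverse.finrank_eigenLine_eq_one _ _ hHD hI _ σ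
    (finrank_iInf_eigenspace_cmCode K Φ σ h₃)

/-- **M13 `Fact_alphaLine`** for `universe₂` — the CM-type condition for the chosen `A_{(K,Φ)}`. [folklore] -/
theorem universe₂_fact_alphaLine (hHD : exists_isReal_hodgeModel) (hI : hodgePQ_independent_of_hodgeModel)
    (hU : BallQuotientUniformisedDatum) (h₃ : CMAbelianVarietyRealised) : (universe₂ hHD hI hU h₃).Fact_alphaLine :=
  fun K Φ σ ↦
    ⟨fun hσ ↦ BettiUniverse.eigenPiece_one_zero_eq_eigenLine _ _ hHD hI _ σ
        (hodgeType_of_mem_cmCode K Φ σ h₃ hσ),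
      fun hσ ↦ BettiUniverse.eigenPiece_one_zero_eq_bot _ _ hHD hI _ σ
        (hodgeType_of_not_mem_cmCode K Φ σ h₃ hσ)⟩

/-- **M24 `Fact_cmEnd`** for `universe₂` (`BettiUniverse.exists_pull_eq_cmEndAction`). [folklore] -/
theorem universe₂_fact_cmEnd (hHD : exists_isReal_hodgeModel) (hI : hodgePQ_independent_of_hodgeModel)
    (hU : BallQuotientUniformisedDatum) (h₃ : CMAbelianVarietyRealised) : (universe₂ hHD hI hU h₃).Fact_cmEnd :=
  fun _ _ a ↦ BettiUniverse.exists_pull_eq_cmEndAction _ _ hHD hI _ a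

/-- **M18 `Fact_lift`** for `universe₂`: the universal property of the product `X ×_ℂ Y` (cartesian
monoidal structure of `SchemeOver ℂ`). [folklore] -/
theorem universe₂_fact_lift (hHD : exists_isReal_hodgeModel) (hI : hodgePQ_independent_of_hodgeModel)
    (hU : BallQuotientUniformisedDatum) (h₃ : CMAbelianVarietyRealised) : (universe₂ hHD hI hU h₃).Fact_lift :=
  fun _ _ _ f g ↦ ⟨CartesianMonoidalCategory.lift f g, CartesianMonoidalCategory.lift_fst f g,
    CartesianMonoidalCategory.lift_snd f g⟩

end Model2

end Summit.HodgeConjecture.CorCM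

end

noncomputable section

open CategoryTheory MonoidalCategory NumberField
open Literature.AlgebraicGeometry.Motives (CMType AbelianVariety IsSmoothProjective)
open Literature.AlgebraicGeometry.Motives
open Literature.AlgebraicGeometry.ComplexMultiplication (Shimura1998_Thm3_isogenousPower Shimura1998_Thm2_Cor)
open Literature.AlgebraicGeometry.Milne1999 (IsOfCMType)

namespace Summit.HodgeConjecture.CorCM

namespace Model2

open Literature.NumberTheory.Automorphic
open Literature.NumberTheory.Automorphic.PicardCM (BallQuotientUniformisedDatum CMAbelianVarietyRealised)
open Literature.AlgebraicGeometry.HodgeTheory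
open Summit.HodgeConjecture.CorCM
open Summit.HodgeConjecture.CorCM.Domination


/-- The interpretation of the PKG product `U.cmProd F Θ` in `universe₂` IS (definitionally, factor by
factor) the underlying variety of the tree's `cmProdAV F h₃ n Θ`. [folklore] -/
theorem scheme_cmProd_universe₂ (hHD : exists_isReal_hodgeModel) (hI : hodgePQ_independent_of_hodgeModel)
    (hU : BallQuotientUniformisedDatum) (h₃ : CMAbelianVarietyRealised) (F : CMField) :
    ∀ (n : ℕ) (Θ : Fin (n + 1) → CMType F),
      IsoComplete.Var.scheme hU h₃ ((universe₂ hHD hI hU h₃).cmProd F Θ) = (cmProdAV F h₃ n Θ).X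
  | 0, Θ => rfl
  | n + 1, Θ => by
      change IsoComplete.Var.scheme hU h₃ ((universe₂ hHD hI hU h₃).cmProd F (fun i => Θ i.castSucc)) ⊗
          IsoComplete.Var.scheme hU h₃ ((universe₂ hHD hI hU h₃).cmAV F (Θ (Fin.last (n + 1)))) = _
      rw [scheme_cmProd_universe₂ hHD hI hU h₃ F n]
      rfl

/-! ### M14 for `universe₂` (v2) -/

/-- **M14 `Fact_cmDominated` for `universe₂` from all-dimensions domination**: if every complex abelian variety of CM
type is dominated, as an abelian variety, by some `∏_j A_{(F,Θ_j)}` over a Galois CM field `F` of degree `≥ 6`, then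
every CM-flagged code of the iso-complete universe (whose interpretation is `ℂ`-isomorphic to such an `A`) is dominated
by the interpretation of `cmProd F Θ` (`scheme_cmProd_universe₂`, isomorphism transport
`isDominatedBy_of_iso_of_avDominatedBy`). [folklore] -/
theorem universe₂_fact_cmDominated_of (hHD : exists_isReal_hodgeModel) (hI : hodgePQ_independent_of_hodgeModel)
    (hU : BallQuotientUniformisedDatum) (h₃ : CMAbelianVarietyRealised)
    (hdom : ∀ A : AbelianVariety ℂ, IsOfCMType A →
      ∃ (F : Type) (_ : Field F) (_ : NumberField F) (_ : IsCMField F),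
        IsGalois ℚ F ∧ 6 ≤ Module.finrank ℚ F ∧
          ∃ (n : ℕ) (Θ : Fin (n + 1) → CMType F), AVDominatedBy A (cmProdAV F h₃ n Θ)) :
    (universe₂ hHD hI hU h₃).Fact_cmDominated := by
  rintro X ⟨A, hCM, ⟨e⟩⟩
  obtain ⟨F, _, _, _, hGal, h6, n, Θ, hdom⟩ := hdom A hCM
  have hX : IsDominatedBy (IsoComplete.Var.scheme hU h₃ X)
      (IsoComplete.Var.scheme hU h₃ ((universe₂ hHD hI hU h₃).cmProd ⟨F⟩ Θ)) :=
    (isDominatedBy_of_iso_of_avDominatedBy e hdom).of_iso_right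
      (eqToIso (scheme_cmProd_universe₂ hHD hI hU h₃ ⟨F⟩ n Θ).symm)
  obtain ⟨s, π, N, hN, hsπ⟩ := hX
  exact ⟨⟨F⟩, hGal, h6, n, Θ, s, π, N, hN, hsπ⟩

/-- **M14 `Fact_cmDominated` for the iso-complete universe `universe₂`** (v2, GUARDED), over the binders `hd`
(Shimura 1998 §6.2 Thm. 3), `hcor` (§6.1 Cor. of Thm. 2) and the GUARDED coding binder `hDomPos` (B03 v2 =
`CMDominatedByCodesPos hU h₃`, verbatim the binder of `Milne1999.forall_cmHodgeHypothesisAt_of_codesHC_pos`): the cell's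
`Domination.cmDominated_of_isOfCMType_all` (dimension `0` settled inside: a point is dominated by anything).
[cite: Shimura1998, §5.1, §6.1 Corollary of Theorem 2, §6.2 Theorem 3, §18.2 Lemma] -/
theorem universe₂_fact_cmDominated (hHD : exists_isReal_hodgeModel) (hI : hodgePQ_independent_of_hodgeModel)
    (hU : BallQuotientUniformisedDatum) (h₃ : CMAbelianVarietyRealised)
    (hd : Shimura1998_Thm3_isogenousPower) (hcor : Shimura1998_Thm2_Cor)
    (hDomPos : ∀ A : AbelianVariety ℂ, 0 < A.dim → IsOfCMType A →
      ∃ (v : PicardCM.Var) (B : AbelianVariety ℂ), PicardCM.Var.IsCMAbelianVariety h₃ v ∧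
        B.X = PicardCM.Var.scheme hU h₃ v ∧ AbelianVariety.IsIsogenous A B) :
    (universe₂ hHD hI hU h₃).Fact_cmDominated :=
  universe₂_fact_cmDominated_of hHD hI hU h₃ (cmDominated_of_isOfCMType_all hU h₃ hd hcor hDomPos)

/-- **M14 `Fact_cmDominated` for `universe₂` MODULO RIEMANN'S THEOREM ONLY** (row B02, the displayed binder `hR` of
`HC_CM_of_PerLFace`): `Domination.cmDominated_of_isOfCMType_all_of_riemann`.
[cite: Shimura1998, §5.1 Props. 3–6, §6.1 Corollary of Theorem 2, §6.2 Theorem 3, §18.2 Lemma (ii)–(iii)]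
[cite: DeligneMilne1982Tannakian, §6 Thm. 6.20 (Riemann), print p. 212] -/
theorem universe₂_fact_cmDominated_of_riemann (hHD : exists_isReal_hodgeModel)
    (hI : hodgePQ_independent_of_hodgeModel) (hU : BallQuotientUniformisedDatum) (h₃ : CMAbelianVarietyRealised)
    (hR : DeligneMilne1982_Thm_6_20_full) : (universe₂ hHD hI hU h₃).Fact_cmDominated :=
  universe₂_fact_cmDominated_of hHD hI hU h₃ (cmDominated_of_isOfCMType_all_of_riemann hR hU h₃)

end Model2

end Summit.HodgeConjecture.CorCM

end
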